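import Mathlib
import Literature.Barriers.MatrixMultiplication.NormalizerBarrier
import Summits.MatrixMultiplication.MatrixMultiplication.Theorems.SubgroupIdentityDesigns.Negative.BlockSliceTypes
import Summits.MatrixMultiplication.MatrixMultiplication.Theorems.SubgroupIdentityDesigns.Negative.BlockSlicePacking

/-!
# Packing no-go for block slices: `V² ≤ |GL_k|³ · q^{5kl} < D⁶`
(negative-side theorem for the crux `SubgroupIdentityDesigns`, stmt-MatrixMultiplication-14079; cell B2b-5, gen 9)

Formalises the group-theoretic half of THEOREM 2.4 of the block-slice analysis
(`run/shared/lean/b2b/levelgraded-cu/b2b-lgcu-borel-g8/BLOCK-SLICES.md` §2).  Setting: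
`G = GL (Fin k ⊕ Fin l) F` over a finite field `F` with `q = |F|`, blocks `g = (A B; C D)`,
block slice `S = {D = 1}`, and a subgroup-TPP triple `H₁, H₂, H₃ ≤ G` with `H₁ H₂ H₃ ⊆ S`
— the configuration on which level-`k` identity designs come for free (the interpolation designs of
gens 7–8: `F_k ⊇` functions of the last `l` columns, so `𝟙_S` has level `≤ k` and is an identity design
for every TPP triple inside `S`).  Writing `Uᵢ = U_{Hᵢ}`, `Kᵢ = K_{Hᵢ}` (`BlockSliceTypes`):

* `volume_sq_le` — **THEOREM 2.4 (group side)**: `(|H₁||H₂||H₃|)² ≤ |GL_k(F)|³ · q^{5kl}`.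
  Proof: the three pair bounds `BlockSlicePacking.pair_bound` with exponents
  `eᵢⱼ = dim(Uᵢ + Uⱼ) + k - dim(Kᵢ ∩ Kⱼ)`; the cross conditions `U₂, U₃ ≤ K₁`, `U₃ ≤ K₂`
  (`BlockSliceTypes.USpan_le_KInf`) give `U₂ + U₃ ≤ K₁ ∩ K₂`, whence `e₁₂ + e₂₃ ≤ 3k`, `e₁₃ ≤ 2k`.
* `card_GL_lt` — `|GL_k(F)| < q^{k²}` (`k ≥ 1`).
* `volume_sq_lt` — numeric form: for `k ≥ 1`, `V² < q^{3k² + 5kl}`, and if moreover `l ≥ 3` then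
  `V² < (q^{kl + k(k-1)/2})⁶`, i.e. `V < D³` with `D = q^{kl + k(k-1)/2}`.
* `volume_sq_le_of_hom`, `volume_sq_le_conj`, `volume_sq_le_fin` — transport: along any injective
  homomorphism into `GL (Fin k ⊕ Fin l) F`, to conjugate slices `x S x⁻¹`, and to `GL (Fin (k + l)) F`
  (slice = the lower-right `l × l` block of `a b c`, rows/columns `k … k+l-1`, is the identity) via
  the reindexing isomorphism `toSum : GL (Fin (k + l)) F ≃* GL (Fin k ⊕ Fin l) F`.

`D` is a lower bound for the degree `q^{k(k+1)/2}·[k+l-1 choose k]_q` of the unipotent character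
`χ^{(l,1^k)}` of `GL_{k+l}(𝔽_q)`, which has level `≤ k` (BLOCK-SLICES Lemma 2.1 — standard
Harish-Chandra/Pieri facts, NOT formalised here).  Granting that fact, the graded Cohn–Umans
inequality of the crux, `Σ_{level ≤ k} χ(1)^{2+ε} < V^{(2+ε)/3}`, forces `D³ < V`; so NO subgroup-TPP
triple inside a block slice with `l = m - k ≥ 3` satisfies the design-side inequality, for any `ε > 0`:
interpolation designs cannot drive `ε → 0` (for `l ≤ 2` the level is `≥ m - 2`, i.e. essentially all
characters are in play and the route has no grading gain).  Sorry-free; standard axioms.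
VALUE = theorem (referee-grade no-go for one configuration class), NOT summit progress; the crux
item stays open.
-/

set_option linter.dupNamespace false

open scoped MatrixGroups Matrix
open Literature.Barriers.MatrixMultiplication

namespace Summit.MatrixMultiplication.MatrixMultiplication.Theorems.SubgroupIdentityDesigns.Negative

namespace BlockSliceNoGo

open BlockSliceTypes BlockSlicePacking

variable {F : Type*} [Field F] [Finite F] {k l : ℕ}

/-! ## THEOREM 2.4 (group side) -/

/-- **PACKING NO-GO FOR BLOCK SLICES (BLOCK-SLICES Theorem 2.4, group side).**  For a subgroup-TPP
triple `H₁, H₂, H₃ ≤ GL_{k+l}(F)` whose triple products all lie in the block slice `S = {D = 1}`,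
`(|H₁| |H₂| |H₃|)² ≤ |GL_k(F)|³ · q^{5kl}`. -/
theorem volume_sq_le {H₁ H₂ H₃ : Subgroup (GL (Fin k ⊕ Fin l) F)} (htpp : SubgroupTPP H₁ H₂ H₃)
    (hS : ∀ a ∈ H₁, ∀ b ∈ H₂, ∀ c ∈ H₃, Dblk (a * b * c) = 1) :
    (Nat.card H₁ * Nat.card H₂ * Nat.card H₃) ^ 2 ≤
      Nat.card (GL (Fin k) F) ^ 3 * Nat.card F ^ (5 * k * l) := by
  -- the six slice conditions
  have s₁ : ∀ a ∈ H₁, Dblk a = 1 := fun a ha => by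
    simpa using hS a ha 1 H₂.one_mem 1 H₃.one_mem
  have s₂ : ∀ b ∈ H₂, Dblk b = 1 := fun b hb => by
    simpa using hS 1 H₁.one_mem b hb 1 H₃.one_mem
  have s₃ : ∀ c ∈ H₃, Dblk c = 1 := fun c hc => by
    simpa using hS 1 H₁.one_mem 1 H₂.one_mem c hc
  have s₁₂ : ∀ a ∈ H₁, ∀ b ∈ H₂, Dblk (a * b) = 1 := fun a ha b hb => by
    simpa using hS a ha b hb 1 H₃.one_mem
  have s₂₃ : ∀ b ∈ H₂, ∀ c ∈ H₃, Dblk (b * c) = 1 := fun b hb c hc => by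
    simpa using hS 1 H₁.one_mem b hb c hc
  have s₁₃ : ∀ a ∈ H₁, ∀ c ∈ H₃, Dblk (a * c) = 1 := fun a ha c hc => by
    simpa using hS a ha 1 H₂.one_mem c hc
  -- types and cross conditions
  have t₁ := le_typeGroup (l := l) s₁
  have t₂ := le_typeGroup (l := l) s₂
  have t₃ := le_typeGroup (l := l) s₃
  have u₁ := USpan_le_KInf_self s₁
  have u₂ := USpan_le_KInf_self s₂
  have u₃ := USpan_le_KInf_self s₃
  have c₂₁ : USpan H₂ ≤ KInf H₁ := USpan_le_KInf s₁ s₂ s₁₂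
  have c₃₂ : USpan H₃ ≤ KInf H₂ := USpan_le_KInf s₂ s₃ s₂₃
  have c₃₁ : USpan H₃ ≤ KInf H₁ := USpan_le_KInf s₁ s₃ s₁₃
  -- disjointness from TPP
  have d₁₂ : Disjoint H₁ H₂ := by
    rw [Subgroup.disjoint_def]; intro x hx hx'
    exact (htpp x hx x⁻¹ (H₂.inv_mem hx') 1 H₃.one_mem (by simp)).1
  have d₂₃ : Disjoint H₂ H₃ := by
    rw [Subgroup.disjoint_def]; intro x hx hx'
    exact (htpp 1 H₁.one_mem x hx x⁻¹ (H₃.inv_mem hx') (by simp)).2.1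
  have d₁₃ : Disjoint H₁ H₃ := by
    rw [Subgroup.disjoint_def]; intro x hx hx'
    exact (htpp x hx 1 H₂.one_mem x⁻¹ (H₃.inv_mem hx') (by simp)).1
  -- pair bounds
  have P₁₂ := pair_bound (l := l) u₁ u₂ t₁ t₂ d₁₂
  have P₂₃ := pair_bound (l := l) u₂ u₃ t₂ t₃ d₂₃
  have P₁₃ := pair_bound (l := l) u₁ u₃ t₁ t₃ d₁₃
  -- exponent bounds
  set q := Nat.card F with hq
  have hq1 : 1 ≤ q := Nat.card_pos
  have bU₁₂ : Module.finrank F ↥(USpan H₁ ⊔ USpan H₂) ≤ k :=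
    (Submodule.finrank_le _).trans (Module.finrank_fin_fun F).le
  have bU₁₃ : Module.finrank F ↥(USpan H₁ ⊔ USpan H₃) ≤ k :=
    (Submodule.finrank_le _).trans (Module.finrank_fin_fun F).le
  have bK₁₂ : Module.finrank F ↥(KInf H₁ ⊓ KInf H₂) ≤ k :=
    (Submodule.finrank_le _).trans (Module.finrank_fin_fun F).le
  have bU₂₃ : Module.finrank F ↥(USpan H₂ ⊔ USpan H₃) ≤ Module.finrank F ↥(KInf H₁ ⊓ KInf H₂) :=
    Submodule.finrank_mono (sup_le (le_inf c₂₁ u₂) (le_inf c₃₁ c₃₂))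
  have hexp : l * (Module.finrank F ↥(USpan H₁ ⊔ USpan H₂) + (k - Module.finrank F ↥(KInf H₁ ⊓ KInf H₂)))
      + l * (Module.finrank F ↥(USpan H₂ ⊔ USpan H₃) + (k - Module.finrank F ↥(KInf H₂ ⊓ KInf H₃)))
      + l * (Module.finrank F ↥(USpan H₁ ⊔ USpan H₃) + (k - Module.finrank F ↥(KInf H₁ ⊓ KInf H₃)))
      ≤ 5 * k * l := by
    have h5 : (Module.finrank F ↥(USpan H₁ ⊔ USpan H₂) + (k - Module.finrank F ↥(KInf H₁ ⊓ KInf H₂)))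
        + (Module.finrank F ↥(USpan H₂ ⊔ USpan H₃) + (k - Module.finrank F ↥(KInf H₂ ⊓ KInf H₃)))
        + (Module.finrank F ↥(USpan H₁ ⊔ USpan H₃) + (k - Module.finrank F ↥(KInf H₁ ⊓ KInf H₃)))
        ≤ 5 * k := by omega
    calc _ = l * ((Module.finrank F ↥(USpan H₁ ⊔ USpan H₂) +
              (k - Module.finrank F ↥(KInf H₁ ⊓ KInf H₂)))
          + (Module.finrank F ↥(USpan H₂ ⊔ USpan H₃) + (k - Module.finrank F ↥(KInf H₂ ⊓ KInf H₃)))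
          + (Module.finrank F ↥(USpan H₁ ⊔ USpan H₃) + (k - Module.finrank F ↥(KInf H₁ ⊓ KInf H₃)))) := by
            ring
      _ ≤ l * (5 * k) := Nat.mul_le_mul_left _ h5
      _ = 5 * k * l := by ring
  calc (Nat.card H₁ * Nat.card H₂ * Nat.card H₃) ^ 2
      = (Nat.card H₁ * Nat.card H₂) * (Nat.card H₂ * Nat.card H₃) * (Nat.card H₁ * Nat.card H₃) := by
        ring
    _ ≤ _ := Nat.mul_le_mul (Nat.mul_le_mul P₁₂ P₂₃) P₁₃
    _ = Nat.card (GL (Fin k) F) ^ 3 * q ^ (l * (Module.finrank F ↥(USpan H₁ ⊔ USpan H₂) +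
            (k - Module.finrank F ↥(KInf H₁ ⊓ KInf H₂)))
          + l * (Module.finrank F ↥(USpan H₂ ⊔ USpan H₃) + (k - Module.finrank F ↥(KInf H₂ ⊓ KInf H₃)))
          + l * (Module.finrank F ↥(USpan H₁ ⊔ USpan H₃) + (k - Module.finrank F ↥(KInf H₁ ⊓ KInf H₃)))) := by
        rw [pow_add, pow_add]; ring
    _ ≤ Nat.card (GL (Fin k) F) ^ 3 * q ^ (5 * k * l) :=
        Nat.mul_le_mul_left _ (Nat.pow_le_pow_right hq1 hexp)

/-! ## Numeric form -/

/-- `|GL_k(F)| < q^{k²}` for `k ≥ 1` (the zero matrix is not invertible). -/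
theorem card_GL_lt (hk : 1 ≤ k) : Nat.card (GL (Fin k) F) < Nat.card F ^ (k * k) := by
  classical
  haveI : Nonempty (Fin k) := ⟨⟨0, hk⟩⟩
  haveI := Fintype.ofFinite F
  haveI : Fintype (GL (Fin k) F) := Fintype.ofFinite _
  have h1 : Nat.card (GL (Fin k) F) < Nat.card (Matrix (Fin k) (Fin k) F) := by
    rw [Nat.card_eq_fintype_card, Nat.card_eq_fintype_card]
    refine Fintype.card_lt_of_injective_of_notMem Units.val Units.val_injective (b := 0) ?_
    rintro ⟨u, hu⟩
    exact zero_ne_one (isUnit_zero_iff.mp (hu ▸ u.isUnit))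
  have h2 : Nat.card (Matrix (Fin k) (Fin k) F) = Nat.card F ^ (k * k) := by
    rw [show Nat.card (Matrix (Fin k) (Fin k) F) = Nat.card (Fin k → Fin k → F) from rfl,
      Nat.card_fun, Nat.card_fun, Nat.card_fin, ← pow_mul]
  omega

/-- **Numeric packing bound.**  For `k ≥ 1`: `V² < q^{3k² + 5kl}`; consequently for `l ≥ 3`:
`V² < (q^{kl + k(k-1)/2})⁶`, i.e. `V < D³` with `D = q^{kl + k(k-1)/2} ≤ deg χ^{(l,1^k)}`
(BLOCK-SLICES Lemma 2.1: a level-`≤ k` character of that degree makes the graded budget `≥ D^{2+ε}`,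
so the crux's design-side inequality would need `V > D³` — impossible in a block slice with `l ≥ 3`). -/
theorem volume_sq_lt (hk : 1 ≤ k) {H₁ H₂ H₃ : Subgroup (GL (Fin k ⊕ Fin l) F)}
    (htpp : SubgroupTPP H₁ H₂ H₃) (hS : ∀ a ∈ H₁, ∀ b ∈ H₂, ∀ c ∈ H₃, Dblk (a * b * c) = 1) :
    (Nat.card H₁ * Nat.card H₂ * Nat.card H₃) ^ 2 < Nat.card F ^ (3 * (k * k) + 5 * k * l) ∧
    (3 ≤ l → (Nat.card H₁ * Nat.card H₂ * Nat.card H₃) ^ 2 <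
      (Nat.card F ^ (k * l + k * (k - 1) / 2)) ^ 6) := by
  set q := Nat.card F with hq
  have hq1 : 1 ≤ q := Nat.card_pos
  have h0 := volume_sq_le (l := l) htpp hS
  have hGL := card_GL_lt (F := F) hk
  have h1 : (Nat.card H₁ * Nat.card H₂ * Nat.card H₃) ^ 2 < q ^ (3 * (k * k) + 5 * k * l) := by
    calc (Nat.card H₁ * Nat.card H₂ * Nat.card H₃) ^ 2
        ≤ Nat.card (GL (Fin k) F) ^ 3 * q ^ (5 * k * l) := h0
      _ < (q ^ (k * k)) ^ 3 * q ^ (5 * k * l) :=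
          Nat.mul_lt_mul_of_pos_right (Nat.pow_lt_pow_left hGL (by norm_num))
            (Nat.pow_pos hq1)
      _ = q ^ (3 * (k * k) + 5 * k * l) := by rw [← pow_mul, ← pow_add]; ring_nf
  refine ⟨h1, fun hl => lt_of_lt_of_le h1 ?_⟩
  rw [← pow_mul]
  apply Nat.pow_le_pow_right hq1
  -- 3k² + 5kl ≤ 6 (kl + k(k-1)/2)
  obtain ⟨j, rfl⟩ : ∃ j, k = j + 1 := ⟨k - 1, by omega⟩
  have hev : 2 * ((j + 1) * (j + 1 - 1) / 2) = (j + 1) * (j + 1 - 1) :=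
    Nat.two_mul_div_two_of_even (Nat.even_mul_pred_self (j + 1))
  have hj : j + 1 - 1 = j := by omega
  rw [hj] at hev ⊢
  have hl3 : (j + 1) * 3 ≤ (j + 1) * l := Nat.mul_le_mul_left _ hl
  nlinarith [hev, hl3]

/-! ## Transport to `GL (Fin (k + l)) F` -/

/-- Reindexing `Fin (k + l) ≃ Fin k ⊕ Fin l` as an isomorphism of general linear groups. -/
def toSum : GL (Fin (k + l)) F ≃* GL (Fin k ⊕ Fin l) F :=
  Units.mapEquiv (Matrix.reindexRingEquiv F (finSumFinEquiv (m := k) (n := l)).symm).toMulEquiv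

/-- `toSum` as a monoid homomorphism. -/
abbrev toSumHom : GL (Fin (k + l)) F →* GL (Fin k ⊕ Fin l) F :=
  (toSum (F := F) (k := k) (l := l)).toMonoidHom

omit [Finite F] in
/-- `toSumHom` is injective. -/
theorem toSumHom_injective : Function.Injective (toSumHom (F := F) (k := k) (l := l)) :=
  (toSum (F := F) (k := k) (l := l)).injective

omit [Finite F] in
/-- Entries of the lower-right block after reindexing: `D(toSum g)ᵢⱼ = g_{k+i, k+j}`. -/
theorem Dblk_toSum (g : GL (Fin (k + l)) F) (i j : Fin l) :
    Dblk (toSumHom g) i j =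
      (g : Matrix (Fin (k + l)) (Fin (k + l)) F) (Fin.natAdd k i) (Fin.natAdd k j) := by
  simp [Dblk, toSumHom, toSum, Matrix.toBlocks₂₂, Units.coe_mapEquiv, Matrix.reindex_apply,
    Matrix.submatrix_apply]

/-- **Transport along an injective homomorphism** `φ : G' → GL_{k+l}(F)`: the bound holds for a
subgroup-TPP triple of `G'` whose triple products are mapped into the slice. -/
theorem volume_sq_le_of_hom {G' : Type*} [Group G'] (φ : G' →* GL (Fin k ⊕ Fin l) F)
    (hφ : Function.Injective φ) {H₁ H₂ H₃ : Subgroup G'} (htpp : SubgroupTPP H₁ H₂ H₃)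
    (hS : ∀ a ∈ H₁, ∀ b ∈ H₂, ∀ c ∈ H₃, Dblk (φ (a * b * c)) = 1) :
    (Nat.card H₁ * Nat.card H₂ * Nat.card H₃) ^ 2 ≤
      Nat.card (GL (Fin k) F) ^ 3 * Nat.card F ^ (5 * k * l) := by
  have htpp' : SubgroupTPP (H₁.map φ) (H₂.map φ) (H₃.map φ) := by
    rintro _ ⟨a, ha, rfl⟩ _ ⟨b, hb, rfl⟩ _ ⟨c, hc, rfl⟩ h
    rw [← map_mul, ← map_mul, map_eq_one_iff _ hφ] at h
    obtain ⟨rfl, rfl, rfl⟩ := htpp a ha b hb c hc h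
    simp
  have hS' : ∀ a ∈ H₁.map φ, ∀ b ∈ H₂.map φ, ∀ c ∈ H₃.map φ, Dblk (a * b * c) = 1 := by
    rintro _ ⟨a, ha, rfl⟩ _ ⟨b, hb, rfl⟩ _ ⟨c, hc, rfl⟩
    rw [← map_mul, ← map_mul]
    exact hS a ha b hb c hc
  have h := volume_sq_le htpp' hS'
  rwa [Subgroup.card_map_of_injective hφ, Subgroup.card_map_of_injective hφ,
    Subgroup.card_map_of_injective hφ] at h

/-- **Conjugate slices.**  The bound for triples whose products lie in a conjugate slice
`x S x⁻¹ = {g : D(x⁻¹ g x) = 1}`. -/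
theorem volume_sq_le_conj (x : GL (Fin k ⊕ Fin l) F) {H₁ H₂ H₃ : Subgroup (GL (Fin k ⊕ Fin l) F)}
    (htpp : SubgroupTPP H₁ H₂ H₃)
    (hS : ∀ a ∈ H₁, ∀ b ∈ H₂, ∀ c ∈ H₃, Dblk (x⁻¹ * (a * b * c) * x) = 1) :
    (Nat.card H₁ * Nat.card H₂ * Nat.card H₃) ^ 2 ≤
      Nat.card (GL (Fin k) F) ^ 3 * Nat.card F ^ (5 * k * l) :=
  volume_sq_le_of_hom (MulAut.conj x⁻¹).toMonoidHom (MulAut.conj x⁻¹).injective htpp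
    (fun a ha b hb c hc => by simpa [MulAut.conj_apply, mul_assoc] using hS a ha b hb c hc)

/-- **THEOREM 2.4 in `GL_{k+l}(F)` coordinates.**  If `H₁, H₂, H₃ ≤ GL_{k+l}(F)` satisfy the
subgroup TPP and every triple product `a b c` has lower-right `l × l` block equal to the identity
(rows/columns `k, …, k+l-1`), then `(|H₁||H₂||H₃|)² ≤ |GL_k(F)|³ · q^{5kl}`. -/
theorem volume_sq_le_fin {H₁ H₂ H₃ : Subgroup (GL (Fin (k + l)) F)} (htpp : SubgroupTPP H₁ H₂ H₃)
    (hS : ∀ a ∈ H₁, ∀ b ∈ H₂, ∀ c ∈ H₃, ∀ i j : Fin l,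
      ((a * b * c : GL (Fin (k + l)) F) : Matrix (Fin (k + l)) (Fin (k + l)) F)
        (Fin.natAdd k i) (Fin.natAdd k j) = (1 : Matrix (Fin l) (Fin l) F) i j) :
    (Nat.card H₁ * Nat.card H₂ * Nat.card H₃) ^ 2 ≤
      Nat.card (GL (Fin k) F) ^ 3 * Nat.card F ^ (5 * k * l) :=
  volume_sq_le_of_hom toSumHom toSumHom_injective htpp fun a ha b hb c hc => by
    ext i j
    rw [Dblk_toSum]
    exact hS a ha b hb c hc i j

end BlockSliceNoGo

end Summit.MatrixMultiplication.MatrixMultiplication.Theorems.SubgroupIdentityDesigns.Negative
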